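import Literature.MathematicalPhysics.QuantumManyBody.PeriodicFormDomain
import Literature.MathematicalPhysics.QuantumManyBody.PeriodicWeightedEnergy
import HarnessLib

/-!
# The form domain of `-∑ⱼΔⱼ + W` on the torus for an abstract weight `W ∈ L¹` of the cell

Topic `Literature/MathematicalPhysics/QuantumManyBody`, abstract-weight twin of `PeriodicFormDomain.lean`
(sequel of `PeriodicWeightedEnergy.lean`). The tree's `PeriodicFormDomain.lean` constructs the form domain
`Q` of `q(Ψ) = ∫_{[0,L)^{3N}} |∇Ψ|² + W|Ψ|²` as a Hilbert space compactly embedded in `L²((ℝ/ℤ)^{3N})`, but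
with the weight hard-wired to the PAIR interaction `W = periodicInteraction v L = ∑_{i<j} v^per(xᵢ - xⱼ)` of a
profile `v`. Its proofs use exactly two properties of the weight: measurability and `∫_{[0,L)^{3N}} W < ∞`.
This file re-runs the construction VERBATIM for an abstract weight `W : Config N → [0, ∞]` under these two
hypotheses (`hWm : Measurable W`, `hW : ∫⁻ X in cellN N L, W X ≠ ⊤`), so that one-body weights (a pinned
scatterer, `PeriodicBoseGasImpurity.lean`), pair-plus-one-body weights, and any other integrable weight are
covered; every declaration `X` of the pair file has the twin `XW` here with the same statement and proof
(`periodicInteraction v L ↦ W`). The `W`-independent part of the pair file (the core `periodicCore`, the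
component index `CompIdx`, `cellScale`, the pointwise `√W` algebra, the Fourier dictionary
`inner_mFourierLp_toLp`) is imported, not duplicated.

**Contents.** `compFunW W Ψ = (Ψ, (∂_{i,k}Ψ)_{i,k}, √W Ψ)`; the `L²((ℝ/ℤ)^{3N})` classes `compLpW` of the
transported components; the **graph embedding** `graphEmbedW : 𝒞 →ₗ[ℂ] ⨁_c L²`
[ReedSimonI1980, §VIII.6]; the **form domain** `formDomainW = closure (range graphEmbedW)` (a Hilbert space);
the **embedding** `formEmbedW : formDomainW →L[ℂ] L²` (value component) [ReedSimonIV1978, Thm. XIII.64];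
the dense core `coreRangeW` (`dense_coreRangeW`). The norm dictionary, closability
(`formEmbedW_injective`) and Rellich compactness (`isCompactOperator_formEmbedW`) are in the sequels
`PeriodicWeightedFormClosable.lean`, `PeriodicWeightedFormCompact.lean`.

## References
* [ReedSimonIV1978] Reed–Simon IV, Thm. XIII.64 (compact resolvent ⇔ compact form embedding), XIII.73–74.
* [ReedSimonI1980] Reed–Simon I, §VIII.6 (closed and closable forms, form cores).
-/

noncomputable section

open MeasureTheory Filter Set WithLp Complex UnitAddTorus
open scoped ENNReal NNReal Topology ComplexConjugate InnerProductSpace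

namespace Literature.MathematicalPhysics.QuantumManyBody.BoseGas

-- The measure on `ℝ/ℤ` is the Haar PROBABILITY measure, as in `PeriodicFormDomain.lean`.
attribute [local instance] formDomain_measureSpace formDomain_isProbabilityMeasure formDomain_isProbabilityMeasure_pi

variable {N : ℕ} {L : ℝ} {W : Config N → ℝ≥0∞}

/-- Local notation for the Hilbert space `H = L²((ℝ/ℤ)^{3N})`. -/
local notation "L2T " N':max => Lp ℂ 2 (volume : Measure (UnitAddTorus (Fin N' × Fin 3)))

/-! ### The components of the graph embedding -/

/-- The configuration-space components `(Ψ, (∂_{i,k}Ψ)_{i,k}, √W Ψ)` of the graph of the form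
`q(Ψ) = ∫ |∇Ψ|² + W|Ψ|²` (abstract weight `W`). [folklore] -/
def compFunW (W : Config N → ℝ≥0∞) (Ψ : Config N → ℂ) : CompIdx N → Config N → ℂ
  | Sum.inl _ => Ψ
  | Sum.inr (Sum.inl p) => fun X => fderiv ℝ Ψ X (Pi.single p.1 (EuclideanSpace.single p.2 1))
  | Sum.inr (Sum.inr _) => fun X => ((Real.sqrt (W X).toReal : ℝ) : ℂ) * Ψ X

/-- The value component. [folklore] -/
@[simp] theorem compFunW_val (W : Config N → ℝ≥0∞) (Ψ : Config N → ℂ) (u : Unit) :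
    compFunW W Ψ (Sum.inl u) = Ψ := rfl

/-- The gradient components. [folklore] -/
@[simp] theorem compFunW_grad (W : Config N → ℝ≥0∞) (Ψ : Config N → ℂ) (p : Fin N × Fin 3) :
    compFunW W Ψ (Sum.inr (Sum.inl p)) =
      fun X => fderiv ℝ Ψ X (Pi.single p.1 (EuclideanSpace.single p.2 1)) := rfl

/-- The potential component. [folklore] -/
@[simp] theorem compFunW_pot (W : Config N → ℝ≥0∞) (Ψ : Config N → ℂ) (u : Unit) :
    compFunW W Ψ (Sum.inr (Sum.inr u)) =
      fun X => ((Real.sqrt (W X).toReal : ℝ) : ℂ) * Ψ X := rfl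

/-- The components are additive on `C¹` functions. [folklore] -/
theorem compFunW_add {Ψ Φ : Config N → ℂ} (hΨ : ContDiff ℝ 1 Ψ) (hΦ : ContDiff ℝ 1 Φ) (c : CompIdx N) :
    compFunW W (Ψ + Φ) c = compFunW W Ψ c + compFunW W Φ c := by
  rcases c with u | p | u
  · rfl
  · funext X
    simp only [compFunW_grad, Pi.add_apply]
    rw [fderiv_add (hΨ.differentiable one_ne_zero X) (hΦ.differentiable one_ne_zero X)]
    rfl
  · funext X
    simp only [compFunW_pot, Pi.add_apply, mul_add]

/-- The components are homogeneous on `C¹` functions. [folklore] -/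
theorem compFunW_smul {Ψ : Config N → ℂ} (hΨ : ContDiff ℝ 1 Ψ) (a : ℂ) (c : CompIdx N) :
    compFunW W (a • Ψ) c = a • compFunW W Ψ c := by
  rcases c with u | p | u
  · rfl
  · funext X
    simp only [compFunW_grad, Pi.smul_apply]
    rw [fderiv_const_smul (hΨ.differentiable one_ne_zero X)]
    rfl
  · funext X
    simp only [compFunW_pot, Pi.smul_apply, smul_eq_mul]
    ring


/-- `√W` is measurable. [folklore] -/
theorem measurable_sqrt_weight (hWm : Measurable W) :
    Measurable fun X : Config N => ((Real.sqrt (W X).toReal : ℝ) : ℂ) :=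
  Complex.measurable_ofReal.comp (hWm.ennreal_toReal.sqrt)

/-- The components of a core function are measurable. [folklore] -/
theorem measurable_compFunW (hWm : Measurable W) {Ψ : Config N → ℂ} (hΨ : ContDiff ℝ 1 Ψ) (c : CompIdx N) :
    Measurable (compFunW W Ψ c) := by
  rcases c with u | p | u
  · exact hΨ.continuous.measurable
  · exact (continuous_fderiv_config_single hΨ p.1 p.2).measurable
  · exact (measurable_sqrt_weight hWm).mul hΨ.continuous.measurable

/-- `∫_{[0,L)^{3N}} W‖Ψ‖₊² < ∞` for continuous `Ψ` and `W ∈ L¹` of the cell. [folklore] -/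
theorem lintegral_cellN_weight_mul_sq_lt_top {L : ℝ} (hW : ∫⁻ X in cellN N L, W X ≠ ⊤)
    {Ψ : Config N → ℂ} (hΨ : Continuous Ψ) :
    ∫⁻ X in cellN N L, W X * ((‖Ψ X‖₊ : ℝ≥0∞)) ^ 2 < ⊤ := by
  obtain ⟨C, hC0, hC⟩ := exists_bound_on_cellN L hΨ
  have hle : ∀ X ∈ cellN N L, W X * ((‖Ψ X‖₊ : ℝ≥0∞)) ^ 2 ≤
      W X * ENNReal.ofReal (C ^ 2) := fun X hX => by
    gcongr
    rw [coe_nnnorm_sq_eq_ofReal]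
    exact ENNReal.ofReal_le_ofReal (by nlinarith [hC X hX, norm_nonneg (Ψ X)])
  calc ∫⁻ X in cellN N L, W X * ((‖Ψ X‖₊ : ℝ≥0∞)) ^ 2
      ≤ ∫⁻ X in cellN N L, W X * ENNReal.ofReal (C ^ 2) :=
        setLIntegral_mono' (measurableSet_cellN N L) hle
    _ = (∫⁻ X in cellN N L, W X) * ENNReal.ofReal (C ^ 2) :=
        lintegral_mul_const' _ _ ENNReal.ofReal_ne_top
    _ < ⊤ := ENNReal.mul_lt_top hW.lt_top ENNReal.ofReal_lt_top

/-- The squared components of a core function have finite integral over the cell. [folklore] -/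
theorem lintegral_cellN_compFunW_sq_lt_top (hW : ∫⁻ X in cellN N L, W X ≠ ⊤)
    {Ψ : Config N → ℂ} (hΨ : ContDiff ℝ 1 Ψ) (c : CompIdx N) :
    ∫⁻ X in cellN N L, ((‖compFunW W Ψ c X‖₊ : ℝ≥0∞)) ^ 2 < ⊤ := by
  rcases c with u | p | u
  · exact lintegral_cellN_sq_lt_top L hΨ.continuous
  · exact lintegral_cellN_sq_lt_top L (continuous_fderiv_config_single hΨ p.1 p.2)
  · refine lt_of_le_of_lt (lintegral_mono fun X => ?_) (lintegral_cellN_weight_mul_sq_lt_top hW hΨ.continuous)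
    exact nnnorm_sqrt_mul_sq_le _ _

/-- **The components of a core function are square integrable on the torus**, with
`∫_{(ℝ/ℤ)^{3N}} ‖compFunW c ∘ fromUnitTorusN‖₊² = L^{-3N} ∫_{[0,L)^{3N}} ‖compFunW c‖₊²`. [folklore] -/
theorem lintegral_torusFunN_compFunW_sq (hL : 0 < L) (hWm : Measurable W) {Ψ : Config N → ℂ}
    (hΨ : ContDiff ℝ 1 Ψ) (c : CompIdx N) :
    ∫⁻ t, ((‖torusFunN L (compFunW W Ψ c) t‖₊ : ℝ≥0∞)) ^ 2 =
      ((ENNReal.ofReal L ^ 3)⁻¹) ^ N * ∫⁻ X in cellN N L, ((‖compFunW W Ψ c X‖₊ : ℝ≥0∞)) ^ 2 :=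
  lintegral_fromUnitTorusN hL (G := fun X => ((‖compFunW W Ψ c X‖₊ : ℝ≥0∞)) ^ 2)
    ((measurable_compFunW hWm hΨ c).nnnorm.coe_nnreal_ennreal.pow_const 2)

/-- The components of a core function, transported to the torus, are in `L²((ℝ/ℤ)^{3N})`. [folklore] -/
theorem memLp_torusFunN_compFunW (hL : 0 < L) (hWm : Measurable W)
    (hW : ∫⁻ X in cellN N L, W X ≠ ⊤) {Ψ : Config N → ℂ} (hΨ : ContDiff ℝ 1 Ψ)
    (c : CompIdx N) : MemLp (torusFunN L (compFunW W Ψ c)) 2 volume := by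
  refine ⟨((measurable_compFunW hWm hΨ c).comp (measurable_fromUnitTorusN L)).aestronglyMeasurable, ?_⟩
  rw [eLpNorm_lt_top_iff_lintegral_rpow_enorm_lt_top two_ne_zero ENNReal.ofNat_ne_top]
  simp only [ENNReal.toReal_ofNat, enorm_rpow_two_eq_coe_nnnorm_sq]
  rw [show (fun a => ((‖torusFunN L (compFunW W Ψ c) a‖₊ : ℝ≥0∞)) ^ 2) =
    fun t => ((‖torusFunN L (compFunW W Ψ c) t‖₊ : ℝ≥0∞)) ^ 2 from rfl,
    lintegral_torusFunN_compFunW_sq hL hWm hΨ c]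
  exact ENNReal.mul_lt_top (ENNReal.pow_lt_top (ENNReal.inv_lt_top.2
    (ENNReal.pow_pos (ENNReal.ofReal_pos.2 hL) 3))) (lintegral_cellN_compFunW_sq_lt_top hW hΨ c)

/-! ### The graph embedding, the form domain and the embedding `ι` -/

/-- The `L²((ℝ/ℤ)^{3N})` class `L^{3N/2} [compFunW c ∘ fromUnitTorusN L]` of a component of a `C¹`
function. [folklore] -/
def compLpW (hL : 0 < L) (hWm : Measurable W) (hW : ∫⁻ X in cellN N L, W X ≠ ⊤)
    {Ψ : Config N → ℂ} (hΨ : ContDiff ℝ 1 Ψ) (c : CompIdx N) : L2T N :=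
  ((cellScale N L : ℝ) : ℂ) • (memLp_torusFunN_compFunW hL hWm hW hΨ c).toLp (torusFunN L (compFunW W Ψ c))

/-- `compLpW` only depends on the component function. [folklore] -/
theorem compLpW_congr (hL : 0 < L) (hWm : Measurable W) (hW : ∫⁻ X in cellN N L, W X ≠ ⊤)
    {Ψ Φ : Config N → ℂ} (hΨ : ContDiff ℝ 1 Ψ) (hΦ : ContDiff ℝ 1 Φ) {c d : CompIdx N}
    (h : compFunW W Ψ c = compFunW W Φ d) : compLpW hL hWm hW hΨ c = compLpW hL hWm hW hΦ d := by
  unfold compLpW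
  congr 1
  exact MemLp.toLp_congr _ _ (Eventually.of_forall fun t => by simp only [torusFunN, h])

/-- Additivity of `compLpW`. [folklore] -/
theorem compLpW_add (hL : 0 < L) (hWm : Measurable W) (hW : ∫⁻ X in cellN N L, W X ≠ ⊤)
    {Ψ Φ : Config N → ℂ} (hΨ : ContDiff ℝ 1 Ψ) (hΦ : ContDiff ℝ 1 Φ) (c : CompIdx N) :
    compLpW hL hWm hW (hΨ.add hΦ) c = compLpW hL hWm hW hΨ c + compLpW hL hWm hW hΦ c := by
  unfold compLpW
  rw [← smul_add, ← MemLp.toLp_add]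
  congr 1
  exact MemLp.toLp_congr _ _ (Eventually.of_forall fun t => by
    show compFunW W (Ψ + Φ) c (fromUnitTorusN L t) = _
    rw [compFunW_add hΨ hΦ]
    rfl)

/-- Homogeneity of `compLpW`. [folklore] -/
theorem compLpW_smul (hL : 0 < L) (hWm : Measurable W) (hW : ∫⁻ X in cellN N L, W X ≠ ⊤)
    {Ψ : Config N → ℂ} (hΨ : ContDiff ℝ 1 Ψ) (a : ℂ) (haΨ : ContDiff ℝ 1 (a • Ψ)) (c : CompIdx N) :
    compLpW hL hWm hW haΨ c = a • compLpW hL hWm hW hΨ c := by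
  unfold compLpW
  have h1 : (memLp_torusFunN_compFunW hL hWm hW haΨ c).toLp (torusFunN L (compFunW W (a • Ψ) c)) =
      ((memLp_torusFunN_compFunW hL hWm hW hΨ c).const_smul a).toLp (a • torusFunN L (compFunW W Ψ c)) :=
    MemLp.toLp_congr _ _ (Eventually.of_forall fun t => by
      show compFunW W (a • Ψ) c (fromUnitTorusN L t) = _
      rw [compFunW_smul hΨ]
      rfl)
  rw [h1, MemLp.toLp_const_smul, smul_comm]

/-- **The graph embedding** `𝒞 → ⨁_c L²((ℝ/ℤ)^{3N})`, `Ψ ↦ L^{3N/2}(Ψ, (∂_{i,k}Ψ), √W Ψ) ∘ fromUnitTorusN L`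
(a linear map; the graph of the form `q(Ψ) = ∫|∇Ψ|² + W|Ψ|²` over the core).
[cite: ReedSimonI1980, §VIII.6] -/
def graphEmbedW (hL : 0 < L) (hWm : Measurable W) (hW : ∫⁻ X in cellN N L, W X ≠ ⊤) :
    periodicCore N L →ₗ[ℂ] PiLp 2 (fun _ : CompIdx N => L2T N) where
  toFun Ψ := WithLp.toLp 2 fun c => compLpW hL hWm hW Ψ.2.1 c
  map_add' Ψ Φ := by
    ext c : 1
    simp only [PiLp.add_apply]
    exact compLpW_add hL hWm hW Ψ.2.1 Φ.2.1 c
  map_smul' a Ψ := by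
    ext c : 1
    simp only [PiLp.smul_apply, RingHom.id_apply]
    exact compLpW_smul hL hWm hW Ψ.2.1 a (a • Ψ).2.1 c

/-- The components of the graph embedding. [folklore] -/
theorem graphEmbedW_apply (hL : 0 < L) (hWm : Measurable W) (hW : ∫⁻ X in cellN N L, W X ≠ ⊤)
    (Ψ : periodicCore N L) (c : CompIdx N) :
    graphEmbedW hL hWm hW Ψ c = compLpW hL hWm hW Ψ.2.1 c := rfl

/-- **The form domain** `Q`: the closure of the graph of the form over the core, a closed subspace
of the Hilbert space `⨁_c L²((ℝ/ℤ)^{3N})` (hence a Hilbert space). [cite: ReedSimonI1980, §VIII.6] -/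
def formDomainW (hL : 0 < L) (hWm : Measurable W) (hW : ∫⁻ X in cellN N L, W X ≠ ⊤) :
    Submodule ℂ (PiLp 2 (fun _ : CompIdx N => L2T N)) :=
  (LinearMap.range (graphEmbedW hL hWm hW)).topologicalClosure

/-- **The embedding `ι : Q → L²((ℝ/ℤ)^{3N})`** of the form domain (the value component).
[cite: ReedSimonIV1978, Thm. XIII.64] -/
def formEmbedW (hL : 0 < L) (hWm : Measurable W) (hW : ∫⁻ X in cellN N L, W X ≠ ⊤) :
    formDomainW hL hWm hW →L[ℂ] L2T N :=
  (PiLp.proj 2 (fun _ : CompIdx N => L2T N) (Sum.inl ())) ∘L (formDomainW hL hWm hW).subtypeL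

/-- `ι ξ` is the value component of `ξ`. [folklore] -/
theorem formEmbedW_apply (hL : 0 < L) (hWm : Measurable W) (hW : ∫⁻ X in cellN N L, W X ≠ ⊤)
    (ξ : formDomainW hL hWm hW) : formEmbedW hL hWm hW ξ = (ξ : PiLp 2 (fun _ : CompIdx N => L2T N)) (Sum.inl ()) := rfl

/-- The graph of a core function lies in the form domain. [folklore] -/
theorem graphEmbedW_mem_formDomainW (hL : 0 < L) (hWm : Measurable W)
    (hW : ∫⁻ X in cellN N L, W X ≠ ⊤) (Ψ : periodicCore N L) :
    graphEmbedW hL hWm hW Ψ ∈ formDomainW hL hWm hW :=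
  Submodule.le_topologicalClosure _ (LinearMap.mem_range_self _ Ψ)

/-- The core, as a subspace of the form domain (the range of the graph embedding). [folklore] -/
def coreRangeW (hL : 0 < L) (hWm : Measurable W) (hW : ∫⁻ X in cellN N L, W X ≠ ⊤) :
    Submodule ℂ (formDomainW hL hWm hW) :=
  Submodule.comap (formDomainW hL hWm hW).subtype (LinearMap.range (graphEmbedW hL hWm hW))

/-- **The core is dense in the form domain** (a form core, by construction). [cite: ReedSimonI1980, §VIII.6] -/
theorem dense_coreRangeW (hL : 0 < L) (hWm : Measurable W) (hW : ∫⁻ X in cellN N L, W X ≠ ⊤) :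
    Dense (coreRangeW hL hWm hW : Set (formDomainW hL hWm hW)) := by
  rw [Subtype.dense_iff]
  intro x hx
  have hx' : x ∈ closure (LinearMap.range (graphEmbedW hL hWm hW) : Set (PiLp 2 (fun _ : CompIdx N => L2T N))) := by
    rw [← Submodule.topologicalClosure_coe]; exact hx
  refine closure_mono ?_ hx'
  rintro y ⟨Ψ, rfl⟩
  exact ⟨⟨graphEmbedW hL hWm hW Ψ, graphEmbedW_mem_formDomainW hL hWm hW Ψ⟩, ⟨Ψ, rfl⟩, rfl⟩

end Literature.MathematicalPhysics.QuantumManyBody.BoseGas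

end
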